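import Literature.MathematicalPhysics.QuantumFieldTheory.ConformalBootstrap3D.FreeScalarBlockDecomposition
import Mathlib.Tactic
import HarnessLib

/-!
# Mean-field (generalised free field) OPE coefficients in `d = 3`

Fitzpatrick–Kaplan, JHEP 10 (2012) 032 [arXiv:1112.4845], §2.2: in the four-point function
`⟨φφφφ⟩ = (x₁₂²x₃₄²)^{-Δ_φ} (1 + u^{Δ_φ} + (u/v)^{Δ_φ})` of a generalised free field `φ` of dimension
`Δ_φ = p` in `d = 2h` dimensions, the double-twist operators `[φφ]_{n,ℓ}` of dimension `2p + 2n + ℓ` and spin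
`ℓ` appear with the squared OPE coefficients (their `(c̄_{n,ℓ})²` at `Δ₁ = Δ₂ = p`, up to the factor `2` that
counts `u^p` and `(u/v)^p` together for even `ℓ`)

  `P_{n,ℓ}(p) = (p-h+1)_n² (p)_{n+ℓ}² / ( ℓ! n! (ℓ+h)_n (2p+n+1-2h)_n (2p+2n+ℓ-1)_ℓ (2p+n+ℓ-h)_n )`.

This file defines these numbers at `h = 3/2` as explicit real functions (`mftCoeff p n ℓ`, with the rising
factorial `poch x n = x(x+1)⋯(x+n-1)`) in the normalisation `k_{ℓ,0} = 1` of the tree's typed blocks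
(`HasLeadingPart`; at `p = 1/2`, `n = 0` they reduce to `freeScalarOPECoeffSq`/2, `mftCoeff_half_zero`),
proves their positivity for `p > 1/2` (`mftCoeff_pos`) and the two algebraic facts used by the block
decomposition of `u^p + (u/v)^p` (`MeanFieldDecomposition`):

* `mftCoeff_zero_left` — the leading-twist values `P_{0,ℓ}(p) = (p)_ℓ² / (ℓ! (2p+ℓ-1)_ℓ)`;
* `mftCoeff_succ` — the first-order recursion in the twist index with a shifted external dimension,
  `P_{n+1,ℓ}(p) · (n+1)(2ℓ+2n+3)(n+2p-1)(2ℓ+2n+4p-1) = p²(2p-1)² · P_{n,ℓ}(p+1)`,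
  which is how the Casimir pair (quadratic and quartic Casimir, `CasimirPairStencil`) propagates the
  leading-twist data to all twists. This recursion is an exact property of the printed closed form (ours;
  it is the algebraic content of the quartic-Casimir argument, not a statement taken from the source).

No claim about four-point functions is made in this file. [cite: FitzpatrickKaplan2012, §2.2]
-/

namespace Literature.MathematicalPhysics.QuantumFieldTheory.ConformalBootstrap3D

open Finset

/-! ### The rising factorial as an explicit real product -/

/-- The rising factorial (Pochhammer symbol) `(x)_n = x (x+1) ⋯ (x+n-1)` as a real product. [folklore] -/
noncomputable def poch (x : ℝ) (n : ℕ) : ℝ := ∏ i ∈ range n, (x + i)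

/-- `(x)_0 = 1`. [folklore] -/
@[simp] theorem poch_zero (x : ℝ) : poch x 0 = 1 := by simp [poch]

/-- `(x)_{n+1} = (x)_n (x+n)`. [folklore] -/
theorem poch_succ (x : ℝ) (n : ℕ) : poch x (n + 1) = poch x n * (x + n) := by
  simp [poch, prod_range_succ]

/-- `(x)_1 = x`. [folklore] -/
@[simp] theorem poch_one (x : ℝ) : poch x 1 = x := by simp [poch]

/-- `(x)_{n+1} = x (x+1)_n`. [folklore] -/
theorem poch_succ_left (x : ℝ) (n : ℕ) : poch x (n + 1) = x * poch (x + 1) n := by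
  induction n with
  | zero => simp
  | succ n ih =>
    rw [poch_succ, ih, poch_succ]
    push_cast
    ring

/-- `(x)_{m+n} = (x)_m (x+m)_n`. [folklore] -/
theorem poch_add (x : ℝ) (m n : ℕ) : poch x (m + n) = poch x m * poch (x + m) n := by
  induction n with
  | zero => simp
  | succ n ih =>
    rw [← add_assoc, poch_succ, ih, poch_succ]
    push_cast
    ring

/-- `(x)_n > 0` for `x > 0`. [folklore] -/
theorem poch_pos {x : ℝ} (hx : 0 < x) (n : ℕ) : 0 < poch x n :=
  prod_pos fun i _ => by positivity

/-- `(x)_n ≠ 0` for `x > 0`. [folklore] -/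
theorem poch_ne_zero {x : ℝ} (hx : 0 < x) (n : ℕ) : poch x n ≠ 0 := (poch_pos hx n).ne'

/-- `(1)_n = n!`. [folklore] -/
theorem poch_one_left (n : ℕ) : poch 1 n = (n.factorial : ℝ) := by
  induction n with
  | zero => simp
  | succ n ih =>
    rw [poch_succ, ih, Nat.factorial_succ]
    push_cast
    ring

/-- `(ℓ+1)_n · ℓ! = (ℓ+n)!`. [folklore] -/
theorem poch_succ_nat_mul_factorial (ℓ n : ℕ) :
    poch ((ℓ : ℝ) + 1) n * (ℓ.factorial : ℝ) = ((ℓ + n).factorial : ℝ) := by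
  have h := poch_add 1 ℓ n
  rw [poch_one_left, poch_one_left] at h
  rw [mul_comm, ← add_comm (1 : ℝ) ℓ, ← h]

/-- `λ_i = (1/2)_i / i!` (`legendreLam i = C(2i,i)/4^i`). [folklore] -/
theorem legendreLam_eq_poch (i : ℕ) : legendreLam i = poch (1 / 2) i / (i.factorial : ℝ) := by
  induction i with
  | zero => simp
  | succ i ih =>
    rw [legendreLam_succ, ih, poch_succ, Nat.factorial_succ]
    have h1 : (i.factorial : ℝ) ≠ 0 := by positivity
    have h2 : (2 * (i : ℝ) + 2) ≠ 0 := by positivity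
    push_cast
    field_simp
    ring

/-! ### The mean-field coefficients -/

/-- **The mean-field squared OPE coefficient** of the double-twist operator `[φφ]_{n,ℓ}`
(`Δ = 2p + 2n + ℓ`, spin `ℓ`) in the conformal block decomposition of `(u/v)^p` for a generalised free
field of dimension `p` in `d = 3` (`h = 3/2`), in the normalisation `k_{ℓ,0} = 1` of the typed blocks:
`P_{n,ℓ}(p) = (p-1/2)_n² (p)_{n+ℓ}² / ( ℓ! n! (ℓ+3/2)_n (2p+n-2)_n (2p+2n+ℓ-1)_ℓ (2p+n+ℓ-3/2)_n )`.
(Fitzpatrick–Kaplan 2012, §2.2, the general-`d` mean-field formula at `Δ₁ = Δ₂ = p`, `h = 3/2`, without the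
factor `2`.) [cite: FitzpatrickKaplan2012, §2.2] -/
noncomputable def mftCoeff (p : ℝ) (n ℓ : ℕ) : ℝ :=
  poch (p - 1 / 2) n ^ 2 * poch p (n + ℓ) ^ 2 /
    ((ℓ.factorial : ℝ) * (n.factorial : ℝ) * poch ((ℓ : ℝ) + 3 / 2) n * poch (2 * p + n - 2) n *
      poch (2 * p + 2 * n + ℓ - 1) ℓ * poch (2 * p + n + ℓ - 3 / 2) n)

/-- The denominator of `mftCoeff p n ℓ` is positive for `p > 1/2`. [folklore] -/
theorem mftCoeff_den_pos {p : ℝ} (hp : 1 / 2 < p) (n ℓ : ℕ) :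
    0 < (ℓ.factorial : ℝ) * (n.factorial : ℝ) * poch ((ℓ : ℝ) + 3 / 2) n * poch (2 * p + n - 2) n *
      poch (2 * p + 2 * n + ℓ - 1) ℓ * poch (2 * p + n + ℓ - 3 / 2) n := by
  have h1 : (0 : ℝ) < ℓ.factorial := by positivity
  have h2 : (0 : ℝ) < n.factorial := by positivity
  have h3 : 0 < poch ((ℓ : ℝ) + 3 / 2) n := poch_pos (by positivity) n
  have hℓ0 : (0 : ℝ) ≤ ℓ := Nat.cast_nonneg ℓ
  have h4 : 0 < poch (2 * p + n - 2) n := by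
    rcases Nat.eq_zero_or_pos n with h0 | h0
    · subst h0; simp
    · have hn1 : (1 : ℝ) ≤ n := by exact_mod_cast h0
      exact poch_pos (by linarith) n
  have h5 : 0 < poch (2 * p + 2 * n + ℓ - 1) ℓ := by
    have hn0 : (0 : ℝ) ≤ n := Nat.cast_nonneg n
    exact poch_pos (by linarith) ℓ
  have h6 : 0 < poch (2 * p + n + ℓ - 3 / 2) n := by
    rcases Nat.eq_zero_or_pos n with h0 | h0
    · subst h0; simp
    · have hn1 : (1 : ℝ) ≤ n := by exact_mod_cast h0
      exact poch_pos (by linarith) n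
  positivity

/-- **Positivity**: `P_{n,ℓ}(p) > 0` for `p > 1/2` (mean field theory is unitary above the scalar
unitarity bound; at `p = 1/2` the towers `n ≥ 1` are absent, factor `(p-1/2)_n²`). [cite: FitzpatrickKaplan2012, §2.2] -/
theorem mftCoeff_pos {p : ℝ} (hp : 1 / 2 < p) (n ℓ : ℕ) : 0 < mftCoeff p n ℓ := by
  unfold mftCoeff
  have hnum : 0 < poch (p - 1 / 2) n ^ 2 * poch p (n + ℓ) ^ 2 := by
    have h1 : 0 < poch (p - 1 / 2) n := poch_pos (by linarith) n
    have h2 : 0 < poch p (n + ℓ) := poch_pos (by linarith) _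
    positivity
  exact div_pos hnum (mftCoeff_den_pos hp n ℓ)

/-- `P_{n,ℓ}(p) ≥ 0` for `p > 1/2`. [cite: FitzpatrickKaplan2012, §2.2] -/
theorem mftCoeff_nonneg {p : ℝ} (hp : 1 / 2 < p) (n ℓ : ℕ) : 0 ≤ mftCoeff p n ℓ :=
  (mftCoeff_pos hp n ℓ).le

/-- **Leading twist**: `P_{0,ℓ}(p) = (p)_ℓ² / (ℓ! (2p+ℓ-1)_ℓ)`. [cite: FitzpatrickKaplan2012, §2.2] -/
theorem mftCoeff_zero_left (p : ℝ) (ℓ : ℕ) :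
    mftCoeff p 0 ℓ = poch p ℓ ^ 2 / ((ℓ.factorial : ℝ) * poch (2 * p + ℓ - 1) ℓ) := by
  unfold mftCoeff
  simp

/-- **The twist recursion with shifted external dimension** (the algebraic content of the Casimir-pair
argument of `MeanFieldDecomposition`): for every `p`, `n`, `ℓ`, provided the displayed denominators do not
vanish (automatic for `p > 1/2`),
`P_{n+1,ℓ}(p) = p²(2p-1)² / ( (n+1)(2ℓ+2n+3)(n+2p-1)(2ℓ+2n+4p-1) ) · P_{n,ℓ}(p+1)`. [folklore] -/
theorem mftCoeff_succ {p : ℝ} (hp : 1 / 2 < p) (n ℓ : ℕ) :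
    mftCoeff p (n + 1) ℓ =
      p ^ 2 * (2 * p - 1) ^ 2 /
          (((n : ℝ) + 1) * (2 * ℓ + 2 * n + 3) * (n + 2 * p - 1) * (2 * ℓ + 2 * n + 4 * p - 1)) *
        mftCoeff (p + 1) n ℓ := by
  unfold mftCoeff
  -- peel the shifted Pochhammer symbols
  have e1 : poch (p - 1 / 2) (n + 1) = (p - 1 / 2) * poch (p + 1 - 1 / 2) n := by
    rw [poch_succ_left]; ring_nf
  have e2 : poch p (n + 1 + ℓ) = p * poch (p + 1) (n + ℓ) := by
    rw [show n + 1 + ℓ = (n + ℓ) + 1 by ring, poch_succ_left]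
  have e3 : ((n + 1).factorial : ℝ) = ((n : ℝ) + 1) * (n.factorial : ℝ) := by
    rw [Nat.factorial_succ]; push_cast; ring
  have e4 : poch ((ℓ : ℝ) + 3 / 2) (n + 1) = poch ((ℓ : ℝ) + 3 / 2) n * ((ℓ : ℝ) + 3 / 2 + n) :=
    poch_succ _ _
  have e5 : poch (2 * p + ↑(n + 1) - 2) (n + 1) = (2 * p + n - 1) * poch (2 * (p + 1) + n - 2) n := by
    rw [poch_succ_left]; push_cast; ring_nf
  have e6 : poch (2 * p + 2 * ↑(n + 1) + ℓ - 1) ℓ = poch (2 * (p + 1) + 2 * n + ℓ - 1) ℓ := by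
    push_cast; ring_nf
  have e7 : poch (2 * p + ↑(n + 1) + ℓ - 3 / 2) (n + 1) =
      (2 * p + n + ℓ - 1 / 2) * poch (2 * (p + 1) + n + ℓ - 3 / 2) n := by
    rw [poch_succ_left]; push_cast; ring_nf
  rw [e1, e2, e3, e4, e5, e6, e7]
  have hp1 : 1 / 2 < p + 1 := by linarith
  have hden := mftCoeff_den_pos hp1 n ℓ
  have hA : 0 < poch ((ℓ : ℝ) + 3 / 2) n := poch_pos (by positivity) n
  have hn0 : (0 : ℝ) ≤ n := Nat.cast_nonneg n
  have hℓ0 : (0 : ℝ) ≤ ℓ := Nat.cast_nonneg ℓ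
  have hB : 0 < poch (2 * (p + 1) + n - 2) n := poch_pos (by linarith) n
  have hC : 0 < poch (2 * (p + 1) + 2 * n + ℓ - 1) ℓ := poch_pos (by linarith) ℓ
  have hD : 0 < poch (2 * (p + 1) + n + ℓ - 3 / 2) n := poch_pos (by linarith) n
  have hE : (0 : ℝ) < ℓ.factorial := by positivity
  have hF : (0 : ℝ) < n.factorial := by positivity
  have hG : (0 : ℝ) < (n : ℝ) + 1 := by positivity
  have hH : (0 : ℝ) < 2 * ℓ + 2 * n + 3 := by positivity
  have hI : (0 : ℝ) < n + 2 * p - 1 := by linarith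
  have hJ : (0 : ℝ) < 2 * ℓ + 2 * n + 4 * p - 1 := by linarith
  have hK : (0 : ℝ) < (ℓ : ℝ) + 3 / 2 + n := by positivity
  have hL : (0 : ℝ) < 2 * p + n + ℓ - 1 / 2 := by linarith
  field_simp
  ring

end Literature.MathematicalPhysics.QuantumFieldTheory.ConformalBootstrap3D
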